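import Mathlib
import Summits.QuantumFields.BalabanUV.Beta.AnalyticWalkSum216RowData

/-!
# [Balaban1988RG2Cluster] (2.16) p. 16, p. 13 «as before»: VOLUME-FREE row data for MONOMIALLY DECORATED and
# parameter-free walk-term families, and the (T1)-shape END for decorated expansions with volume-free constants
# (cell topic `Summits/QuantumFields/BalabanUV/Beta`; row-D4 rider (ρ3) hand-off socket in the `RowData` currency;
# census `BETA/REMAINDER-BETA.md` §10.23)

HONEST FRAMING (cell rule).  Discharging `BetaPertH` makes Bałaban's UV stability UNCONDITIONAL — a real
constructive-QFT result; NOT the continuum limit, NOT the Clay problem.  This module discharges NOTHING of `BetaPertH`.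
It is the volume-free twin of `AnalyticWalkSum216MonoData` (p214090): the constructors take the SUMMED weighted
majorant `Σ_w c_w‖K_w(i,j)‖` with localised rows (the currency of an4's `AnalyticWalkSum216.wrs_termSum_sub` and of the
co-owner road's `UnitLatticeDecoratedChains.wrs_decoratedSum`) instead of termwise constants, and deliver
`AnalyticWalkSum216RowData.RowData`, so that `RowData.prod`∕`rowData_recomb` (volume-free constants) apply BY NAME.  The
END `wrs_termSum_sub_monomial'` is the volume-free form of an4 gen 35's `AnalyticWalkSum216Monomial.wrs_termSum_sub_monomial`
(whose `Σ_w ρ_w ≤ ρ` is volume-dependent on translation-covariant families — owner XREAD C-an4-89 (f)).  [folklore];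
NO class change on any GAPS row; NOT summit progress.  Unit `b2b-balaban-beta-an4-g37` (owner of `BINDER-OWNERS.md`
row D4); cell `GAPS.md` C-an4-90 (addendum).

CITATION HEADER (lean-in-tree rule).  [II] = T. Bałaban, *Renormalization group approach to lattice gauge field theories.
II. Cluster expansions*, Commun. Math. Phys. **116**, 1–22 (1988) [Balaban1988RG2Cluster], p. 16 [PDF 16] (render
`HOME/b2b-balaban-ref1/pages/1988-cmp116-rg-II-cluster/…-p016-x2.png`, READ AS IMAGE by this lineage gens 32–36),
verbatim: *"|R₁(b, b′)| ≦ (O(1)e^{−1∕3δ₀M} + O(α₀ + α₁))exp(−½δ₀|b₋ − b′₋|). (2.16)"*; p. 13 [PDF 13]: *"The parameters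
s(Δ), Δ∈σ₀, are introduced into the operators as before"*.  Nothing printed is asserted; the walk terms, their majorants
and decorations are HYPOTHESES.

WHAT IS CERTIFIED HERE (kernel, sorry-free; [folklore]).
* `rowData_monoTerm` — frozen-factor bound `‖a_w‖r^{e_w} ≤ c_w`, entrywise summability of `c_w‖K_w(i,j)‖`, localised
  rows of the SUM `Σ_j (Σ_w c_w‖K_w(i,j)‖)e^{κd(i,j)} ≤ ρ` ⟹ `RowData κ d r (monoTerm a e K) (c‖K‖) ρ`;
* `rowData_const_of_wrs` — a parameter-free one-term family from ONE weighted-row-sum bound (index `Unit`), any radius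
  (its summed operator is `K`: `AnalyticWalkSum216MonoData.termSum_const`, in the tree);
* END **`wrs_termSum_sub_monomial'`** — the (2.16)-shape bound `WRS κ d (A(σ) − A(0)) (2ρ/r·‖σ‖)` for a monomially
  decorated expansion from VOLUME-FREE data, and **`wrs_termSum_monomial'`** (at every point: `WRS κ d (A σ) ρ`).
NOT CLAIMED.  Any expansion or decoration of Bałaban's operators; multi-parameter analyticity.  NOT summit progress.
PRIOR ART IN THE TREE (searched 2026-08-20): `AnalyticWalkSum216Monomial` (an4 gen 35: `differentiableOn_monoTerm`,
`norm_monoTerm_le` used BY NAME; its ENDs are the termwise-currency versions), `AnalyticWalkSum216MonoData` (gen 37,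
termwise twin), `AnalyticWalkSum216RowData` (the currency).
-/

namespace Summit.QuantumFields.BalabanUV.Beta.AnalyticWalkSum216RowMonoData

open Metric Set
open Literature.MathematicalPhysics.QuantumFieldTheory.Balaban1983to89
open B13PerturbativeStep (WRS WeightHyp wrs)
open Summit.QuantumFields.BalabanUV.Beta.AnalyticWalkSum216 (termSum majSum)
open Summit.QuantumFields.BalabanUV.Beta.AnalyticWalkSum216Monomial (monoTerm differentiableOn_monoTerm
  norm_monoTerm_le)
open Summit.QuantumFields.BalabanUV.Beta.AnalyticWalkSum216RowData (RowData)

noncomputable section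

variable {n : Type*} [Fintype n] {W : Type*} {κ : ℝ} {d : n → n → ℝ}

/-- **A MONOMIALLY DECORATED FAMILY IS `RowData` FROM VOLUME-FREE DATA**: frozen-factor bound `‖a_w‖·r^{e_w} ≤ c_w`,
entrywise summability of the weighted kernels `Σ_w c_w‖K_w(i,j)‖ < ∞`, and localised rows of their SUM
`Σ_j (Σ_w c_w‖K_w(i,j)‖)e^{κd(i,j)} ≤ ρ` (only walks meeting row `i` count). [cite: Balaban1988RG2Cluster, (1.6)–(1.8) p.3] -/
theorem rowData_monoTerm {a : W → ℂ} {e : W → ℕ} {c : W → ℝ} {r : ℝ} (hc : ∀ w, ‖a w‖ * r ^ e w ≤ c w)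
    (K : W → Matrix n n ℂ) (hsum : ∀ i j, Summable fun w => c w * ‖K w i j‖) {ρ : ℝ}
    (hρ : ∀ i, ∑ j, majSum (fun w i j => c w * ‖K w i j‖) i j * Real.exp (κ * d i j) ≤ ρ) :
    RowData κ d r (monoTerm a e K) (fun w i j => c w * ‖K w i j‖) ρ :=
  ⟨differentiableOn_monoTerm a e K _, norm_monoTerm_le hc K, hsum, hρ⟩

/-- **A PARAMETER-FREE ONE-TERM FAMILY IS `RowData`** on every disc: a fixed matrix `K` with `WRS κ d K k` (a
σ-independent sandwich factor entering a product) — index `Unit`, majorant `‖K(i,j)‖`, constant `k`. [folklore] -/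
theorem rowData_const_of_wrs (K : Matrix n n ℂ) {k : ℝ} (hK : WRS κ d K k) (R : ℝ) :
    RowData κ d R (fun (_ : Unit) (_ : ℂ) => K) (fun _ i j => ‖K i j‖) k where
  ha _ _ _ := differentiableOn_const _
  hm _ _ _ _ _ := le_rfl
  hsum _ _ := .of_finite
  hρ i := by
    refine le_of_eq_of_le (Finset.sum_congr rfl fun j _ => ?_) (hK i)
    simp only [majSum]
    rw [tsum_fintype, Fintype.sum_unique]

/-- **(T1)-SHAPE END FOR MONOMIALLY DECORATED EXPANSIONS, VOLUME-FREE CONSTANTS**: on the disc `‖σ‖ < r`,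
`WRS κ d (termSum (monoTerm a e K) σ − termSum (monoTerm a e K) 0) (2ρ/r·‖σ‖)` from the data of `rowData_monoTerm`
(`RowData.wrs_termSum_sub` = an4's `wrs_termSum_sub` BY NAME) — the volume-free form of
`AnalyticWalkSum216Monomial.wrs_termSum_sub_monomial`. [cite: Balaban1988RG2Cluster, (2.16) p.16] -/
theorem wrs_termSum_sub_monomial' {a : W → ℂ} {e : W → ℕ} {c : W → ℝ} {r : ℝ} (hr : 0 < r)
    (hc : ∀ w, ‖a w‖ * r ^ e w ≤ c w) (K : W → Matrix n n ℂ) (hsum : ∀ i j, Summable fun w => c w * ‖K w i j‖)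
    {ρ : ℝ} (hρ : ∀ i, ∑ j, majSum (fun w i j => c w * ‖K w i j‖) i j * Real.exp (κ * d i j) ≤ ρ)
    {σ : ℂ} (hσ : σ ∈ ball (0 : ℂ) r) :
    WRS κ d (termSum (monoTerm a e K) σ - termSum (monoTerm a e K) 0) (2 * ρ / r * ‖σ‖) :=
  (rowData_monoTerm hc K hsum hρ).wrs_termSum_sub hr hσ

/-- … and at every point of the disc: `WRS κ d (termSum (monoTerm a e K) σ) ρ`. [cite: Balaban1988RG2Cluster, (2.16) p.16] -/
theorem wrs_termSum_monomial' {a : W → ℂ} {e : W → ℕ} {c : W → ℝ} {r : ℝ}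
    (hc : ∀ w, ‖a w‖ * r ^ e w ≤ c w) (K : W → Matrix n n ℂ) (hsum : ∀ i j, Summable fun w => c w * ‖K w i j‖)
    {ρ : ℝ} (hρ : ∀ i, ∑ j, majSum (fun w i j => c w * ‖K w i j‖) i j * Real.exp (κ * d i j) ≤ ρ)
    {σ : ℂ} (hσ : σ ∈ ball (0 : ℂ) r) : WRS κ d (termSum (monoTerm a e K) σ) ρ :=
  (rowData_monoTerm hc K hsum hρ).wrs_termSum hσ

/-! ## Non-vacuity -/

/-- The data of `rowData_monoTerm` are jointly satisfiable: one bond, one walk, `a = 1`, `e = 1`, `K = 1`, `c = 1`,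
`r = 1`, trivial distance, `ρ = 1`. [folklore] -/
example : RowData (n := Unit) (0 : ℝ) (fun _ _ => (0 : ℝ)) 1
    (monoTerm (fun (_ : Unit) => (1 : ℂ)) (fun _ => 1) (fun _ => (1 : Matrix Unit Unit ℂ)))
    (fun _ i j => (1 : ℝ) * ‖(1 : Matrix Unit Unit ℂ) i j‖) 1 := by
  refine rowData_monoTerm (fun _ => by simp) _ (fun _ _ => .of_finite) fun i => ?_
  cases i
  simp [majSum, tsum_fintype]

end

end Summit.QuantumFields.BalabanUV.Beta.AnalyticWalkSum216RowMonoData
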